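import Summits.BirchSwinnertonDyer.BirchSwinnertonDyer.Theorems.GenusKolyvaginAtTwoLeafCensusWallTorsionCell
import HarnessLib

/-!
# Route `GenusKolyvaginAtTwo` — THE Ш-CELL SPLIT of the rank-one half: U₂′ ⟺ U₂ ∧ Ш-cell, R′ ⟺ Ш-cell ∧ R″ (LEAD bsd-line-gk2-p1 g32; census for director-bsd (726)(C))

Seat `bsd-line-gk2-p1` g32 (LEAD lineage, cell `bsd-f1-sign2`).  THEOREMS ONLY, standard axioms, no `sorry`; conditional theorems display their
hypotheses.  **BSD is NOT proved by this file; the leaf `NonCMAtTwo`, the WALL rows, U₂ (22985), R′ (27107), U₂′, R″, the Ш-cell and KEX⁰ stay OPEN;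
nothing is closed; this is NOT a registry proposal.**

CONTEXT.  Director-bsd (726) asks the planner-of-record for a re-cut packet (rev 68): `closes` re-keyed to WALL(GK2)×4 + U₂′ + R″ (the `closes`-shaped
term of p798939 `…Census.TorsionCell`), with U₂′ := «non-CM, `r_an = 1`, `W(ℚ)[2] = 0` ⟹ BSD₂» and R″ := the TORSION cell «non-CM, `r_an = 1`,
`W(ℚ)[2] ≠ 0` ⟹ BSD₂», and (C) LEVER CONTINUITY for LINE 23 `twin_swap` (which concludes U₂ `MinimalTwinBSDTwo` BY NAME): either a v2.6 skeleton with
ONE extra stub for the Ш-cell, or «U₂ kept as a NODE under U₂′ with a PROVED glued split».  This file is that glued split, kernel-checked, with U₂ and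
R′ BY NAME (rev 67 decls) and U₂′ / R″ / the Ш-cell spelled out (no decls yet):

* §1 THREE CELLS of the rank-one half: U₂ (`#Sel₂ = 2`), the Ш-CELL := «non-CM, `r_an = 1`, `W(ℚ)[2] = 0`, `#Sel₂(W) ≠ 2` ⟹ BSD₂», the TORSION cell R″.
  ★ `rankOneNoTwoTorsion_of_minimalTwinBSDTwo_of_shaCell`: **U₂′ ⟸ U₂ ∧ Ш-cell (pure logic)** and `rankOneNoTwoTorsion_iff_minimalTwinBSDTwo_and_shaCell`:
  **U₂′ ⟺ U₂ ∧ Ш-cell** (→ modulo GZK = item `MultPublishedInputsAtTwo`, which turns `#Sel₂ = 2` at analytic rank one into `W(ℚ)[2] = 0`);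
  `rankOneNonMinimalResidualAtTwo_iff_shaCell_and_torsionCell`: **R′ ⟺ Ш-cell ∧ R″** (→ modulo GZK); and «rank-one BSD₂» ⟺ U₂ ∧ Ш-cell ∧ R″ (logic).
* §2 the Ш-cell in Ш-currency (mod GZK): its Selmer clause `#Sel₂(W) ≠ 2` reads `Ш(W)[2] ≠ 0` on curves without rational `2`-torsion (p797081 §1).
* §3 ★ `nonCMAtTwo_of_wallGK2_of_minimalTwinBSDTwo_of_shaCell_of_torsionCell`: the `closes`-shaped term **NonCMAtTwo ⟸ WALL(GK2)×4 + U₂ BY NAME + Ш-cell + R″**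
  (seven binders, one cell each, none idle) and its LOSSLESS converse — so the re-cut with U₂ kept as a node needs no skeleton edit: LINE 23 keeps
  concluding `MinimalTwinBSDTwo` by name, and the ONE new statement is the Ш-cell.
* §4 the Ш-cell's road is U₂'s currency: ★ `shaCell_of_wall_of_friedbergHoffstein_of_kex0Sha_of_facts` — **Ш-cell ⟸ WALL row 1 + Friedberg–Hoffstein +
  KEX⁰|Ш + PRINT**, KEX⁰|Ш := LINE 23's index relation with the Selmer clause replaced by «`W(ℚ)[2] = 0 ∧ #Sel₂(W) ≠ 2`» (p796542's engine is pointwise in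
  `W`, so it restricts to the cell verbatim), and `kex0Sha_of_shaCell_of_wall_of_facts` (lossless).

References: [SilvermanAEC2009] Thm X.4.2; [Miller2011LMS] Def. 1.1; [GrossZagier1986] V.§2 (2.2); [FriedbergHoffstein1995] main theorem;
[Milne1972ArithmeticAV] §1 Thm. 1; [BCDTJAMS2001] Thm. A.
-/

set_option autoImplicit false
set_option linter.dupNamespace false -- `Summit.<P>.<Sub>` repeats `BirchSwinnertonDyer` (D-0017)

noncomputable section

open scoped Classical NumberField

namespace Summit.BirchSwinnertonDyer.BirchSwinnertonDyer.Theorems.GenusExact.Census.ShaCell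

open WeierstrassCurve NumberField Literature.NumberTheory.EllipticCurves
  Literature.NumberTheory.EllipticCurves.ModularForms
  Literature.NumberTheory.EllipticCurves.Rank1Residual
  Literature.NumberTheory.EllipticCurves.Rank1Residual.Typed
  Summit.BirchSwinnertonDyer.Rank1Residual
  Summit.BirchSwinnertonDyer.BirchSwinnertonDyer.Rank1Residual
  Summit.BirchSwinnertonDyer.BirchSwinnertonDyer.Theorems.GenusExact.TwinSwap
  Summit.BirchSwinnertonDyer.BirchSwinnertonDyer.Theorems.GenusExact.TwinSwap.AnalyticTwin
  Summit.BirchSwinnertonDyer.BirchSwinnertonDyer.Theorems.GenusExact.TwinSwap.AnalyticTwin.NoTwoTorsion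
open Summit.BirchSwinnertonDyer.BirchSwinnertonDyer.Theorems.GenusExact.TwinSwap.AnalyticTwin.NoTwoTorsion.Census
  (natCard_selmerGroup_two_ne_two_iff_of_analyticRank_one torsionCell_of_rankOneNonMinimalResidualAtTwo)
open Summit.BirchSwinnertonDyer.BirchSwinnertonDyer.Theorems.GenusExact.Census.TorsionCell
  (nonCMAtTwo_of_wallGK2_of_rankOneNoTwoTorsion_of_torsionCell nonCMAtTwo_iff_wallGK2_and_rankOneNoTwoTorsion_and_torsionCell)
open Summit.BirchSwinnertonDyer.BirchSwinnertonDyer.Theses.GenusKolyvaginAtTwo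
  (WallGoodOrdinaryRankZeroAtTwo WallMultiplicativeRankZeroAtTwo WallSupersingularRankZeroAtTwo WallAdditiveRankZeroAtTwo
   MinimalTwinBSDTwo RankOneNonMinimalResidualAtTwo)
open Summit.BirchSwinnertonDyer.BirchSwinnertonDyer.Theorems.GenusExact.TwinSwap.Ledger.Line25
  (exists_kolyvaginHeegnerData_one_of_nonempty_modularParametrizationData not_isOfFinAddOrder_derivedPoint_one_of_rankOne_of_lValue_ne_zero)
open Summit.BirchSwinnertonDyer.BirchSwinnertonDyer.Theorems.KolyvaginAtTwo (exists_exactTwoDepth)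
open Literature.NumberTheory.QuadraticFields.Quadratic (ncard_primesOver_two_eq_two_iff)

/-! ## §1 Three cells of the rank-one half: U₂ (BY NAME), the Ш-cell, the torsion cell R″; U₂′ ⟺ U₂ ∧ Ш-cell; R′ ⟺ Ш-cell ∧ R″ -/

/-- ★ **U₂′ ⟸ U₂ ∧ Ш-cell — the PROVED GLUED SPLIT, pure logic.**  U₂ = `MinimalTwinBSDTwo` BY NAME (item 22985, rev 67: non-CM, `r_an = 1`,
`#Sel₂(W) = 2` ⟹ BSD₂); Ш-cell := «non-CM, `r_an = 1`, `W(ℚ)[2] = 0`, `#Sel₂(W) ≠ 2` ⟹ BSD₂»; U₂′ := «non-CM, `r_an = 1`, `W(ℚ)[2] = 0` ⟹ BSD₂»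
(p798939's binder `hU`).  `by_cases` on `#Sel₂(W) = 2`.  CONDITIONAL; proves nothing about BSD; closes nothing. [folklore] -/
theorem rankOneNoTwoTorsion_of_minimalTwinBSDTwo_of_shaCell (hU : MinimalTwinBSDTwo)
    (hS : ∀ (W : WeierstrassCurve ℚ) [W.IsElliptic] [W.IsGloballyMinimal],
      ¬ W.HasCM → W.analyticRank = 1 → (∀ P : W.toAffine.Point, 2 • P = 0 → P = 0) → Nat.card (W.selmerGroup 2) ≠ 2 → BSDp W 2) :
    ∀ (W : WeierstrassCurve ℚ) [W.IsElliptic] [W.IsGloballyMinimal],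
      ¬ W.HasCM → W.analyticRank = 1 → (∀ P : W.toAffine.Point, 2 • P = 0 → P = 0) → BSDp W 2 := by
  intro W _ _ hcm hr hT
  by_cases hSel : Nat.card (W.selmerGroup 2) = 2
  · exact hU W hcm hr hSel
  · exact hS W hcm hr hT hSel

/-- **Ш-cell ⟸ U₂′** (the Ш-cell is a sub-statement of U₂′).  Pure logic. [folklore] -/
theorem shaCell_of_rankOneNoTwoTorsion
    (hU' : ∀ (W : WeierstrassCurve ℚ) [W.IsElliptic] [W.IsGloballyMinimal],
      ¬ W.HasCM → W.analyticRank = 1 → (∀ P : W.toAffine.Point, 2 • P = 0 → P = 0) → BSDp W 2) :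
    ∀ (W : WeierstrassCurve ℚ) [W.IsElliptic] [W.IsGloballyMinimal],
      ¬ W.HasCM → W.analyticRank = 1 → (∀ P : W.toAffine.Point, 2 • P = 0 → P = 0) → Nat.card (W.selmerGroup 2) ≠ 2 → BSDp W 2 :=
  fun W _ _ hcm hr hT _ ↦ hU' W hcm hr hT

/-- **U₂ `MinimalTwinBSDTwo` (BY NAME) ⟸ U₂′**, modulo GZK (`rank_eq_analyticRank_of_analyticRank_le_one` = item `MultPublishedInputsAtTwo`): at
analytic rank one the Mordell–Weil rank is `≥ 1`, so `#Sel₂(W) = 2` forces `W(ℚ)[2] = 0` (descent count, Silverman X.4.2, tree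
`rank_eq_one_and_sha_primary_eq_zero_of_natCard_selmerGroup_eq_two`).  CONDITIONAL; closes nothing. [cite: SilvermanAEC2009, Thm X.4.2] -/
theorem minimalTwinBSDTwo_of_rankOneNoTwoTorsion (hGZK : rank_eq_analyticRank_of_analyticRank_le_one)
    (hU' : ∀ (W : WeierstrassCurve ℚ) [W.IsElliptic] [W.IsGloballyMinimal],
      ¬ W.HasCM → W.analyticRank = 1 → (∀ P : W.toAffine.Point, 2 • P = 0 → P = 0) → BSDp W 2) :
    MinimalTwinBSDTwo := by
  intro W _ _ hcm hr hSel
  have hrk : 1 ≤ W.mordellWeilRank := by rw [(hGZK W (le_of_eq hr)).1, hr]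
  obtain ⟨-, hT2, -⟩ := rank_eq_one_and_sha_primary_eq_zero_of_natCard_selmerGroup_eq_two W hSel hrk
  exact hU' W hcm hr (fun P hP ↦ by convert hT2 P (by convert hP))

/-- ★ **U₂′ ⟺ U₂ ∧ Ш-cell** (U₂ BY NAME) — the re-cut's crux U₂′ is EXACTLY U₂ plus the Ш-cell: ← pure logic, → modulo GZK.  LOSSLESS.  CONDITIONAL;
proves nothing about BSD; closes nothing. [cite: SilvermanAEC2009, Thm X.4.2] -/
theorem rankOneNoTwoTorsion_iff_minimalTwinBSDTwo_and_shaCell (hGZK : rank_eq_analyticRank_of_analyticRank_le_one) :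
    (∀ (W : WeierstrassCurve ℚ) [W.IsElliptic] [W.IsGloballyMinimal],
        ¬ W.HasCM → W.analyticRank = 1 → (∀ P : W.toAffine.Point, 2 • P = 0 → P = 0) → BSDp W 2) ↔
      MinimalTwinBSDTwo ∧
        (∀ (W : WeierstrassCurve ℚ) [W.IsElliptic] [W.IsGloballyMinimal],
          ¬ W.HasCM → W.analyticRank = 1 → (∀ P : W.toAffine.Point, 2 • P = 0 → P = 0) → Nat.card (W.selmerGroup 2) ≠ 2 → BSDp W 2) :=
  ⟨fun hU' ↦ ⟨minimalTwinBSDTwo_of_rankOneNoTwoTorsion hGZK hU', shaCell_of_rankOneNoTwoTorsion hU'⟩,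
    fun h ↦ rankOneNoTwoTorsion_of_minimalTwinBSDTwo_of_shaCell h.1 h.2⟩

/-- **Ш-cell ⟸ R′ `RankOneNonMinimalResidualAtTwo`** (BY NAME, item 27107): the Ш-cell is a sub-statement of the rev-67 residual.  Pure logic. [folklore] -/
theorem shaCell_of_rankOneNonMinimalResidualAtTwo (hR : RankOneNonMinimalResidualAtTwo) :
    ∀ (W : WeierstrassCurve ℚ) [W.IsElliptic] [W.IsGloballyMinimal],
      ¬ W.HasCM → W.analyticRank = 1 → (∀ P : W.toAffine.Point, 2 • P = 0 → P = 0) → Nat.card (W.selmerGroup 2) ≠ 2 → BSDp W 2 :=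
  fun W _ _ hcm hr _ hSel ↦ hR W hcm hr hSel

/-- **R′ ⟸ Ш-cell ∧ R″** (R′ BY NAME; R″ = the TORSION cell «non-CM, `r_an = 1`, `W(ℚ)[2] ≠ 0` ⟹ BSD₂», p798939's binder `hT`): `by_cases` on
`W(ℚ)[2] = 0`.  Pure logic.  CONDITIONAL; closes nothing. [folklore] -/
theorem rankOneNonMinimalResidualAtTwo_of_shaCell_of_torsionCell
    (hS : ∀ (W : WeierstrassCurve ℚ) [W.IsElliptic] [W.IsGloballyMinimal],
      ¬ W.HasCM → W.analyticRank = 1 → (∀ P : W.toAffine.Point, 2 • P = 0 → P = 0) → Nat.card (W.selmerGroup 2) ≠ 2 → BSDp W 2)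
    (hT : ∀ (W : WeierstrassCurve ℚ) [W.IsElliptic] [W.IsGloballyMinimal],
      ¬ W.HasCM → W.analyticRank = 1 → (¬ ∀ P : W.toAffine.Point, 2 • P = 0 → P = 0) → BSDp W 2) :
    RankOneNonMinimalResidualAtTwo := by
  intro W _ _ hcm hr hSel
  by_cases htor : ∀ P : W.toAffine.Point, 2 • P = 0 → P = 0
  · exact hS W hcm hr htor hSel
  · exact hT W hcm hr htor

/-- ★ **R′ ⟺ Ш-cell ∧ R″** (R′ BY NAME): the rev-67 residual is EXACTLY the Ш-cell plus the torsion cell — ← pure logic, → modulo GZK (a rank-one curve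
with a rational `2`-torsion point has `#Sel₂ ≠ 2`, p797081 `torsionCell_of_rankOneNonMinimalResidualAtTwo`).  So the re-cut U₂ ↦ U₂′, R′ ↦ R″ MOVES the
Ш-cell from the residual into the crux and nothing else.  CONDITIONAL; closes nothing. [cite: SilvermanAEC2009, Thm X.4.2] -/
theorem rankOneNonMinimalResidualAtTwo_iff_shaCell_and_torsionCell (hGZK : rank_eq_analyticRank_of_analyticRank_le_one) :
    RankOneNonMinimalResidualAtTwo ↔
      (∀ (W : WeierstrassCurve ℚ) [W.IsElliptic] [W.IsGloballyMinimal],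
          ¬ W.HasCM → W.analyticRank = 1 → (∀ P : W.toAffine.Point, 2 • P = 0 → P = 0) → Nat.card (W.selmerGroup 2) ≠ 2 → BSDp W 2) ∧
        (∀ (W : WeierstrassCurve ℚ) [W.IsElliptic] [W.IsGloballyMinimal],
          ¬ W.HasCM → W.analyticRank = 1 → (¬ ∀ P : W.toAffine.Point, 2 • P = 0 → P = 0) → BSDp W 2) :=
  ⟨fun hR ↦ ⟨shaCell_of_rankOneNonMinimalResidualAtTwo hR, torsionCell_of_rankOneNonMinimalResidualAtTwo hGZK hR⟩,
    fun h ↦ rankOneNonMinimalResidualAtTwo_of_shaCell_of_torsionCell h.1 h.2⟩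

/-- **«BSD₂ for every non-CM `W` of analytic rank one» ⟺ U₂ ∧ Ш-cell ∧ R″** (U₂ BY NAME) — the THREE-CELL partition of the rank-one half of the leaf.
Pure logic (no GZK: each cell is a sub-statement, and the three cells cover).  [folklore] -/
theorem rankOneBSDTwo_iff_minimalTwinBSDTwo_and_shaCell_and_torsionCell :
    (∀ (W : WeierstrassCurve ℚ) [W.IsElliptic] [W.IsGloballyMinimal], ¬ W.HasCM → W.analyticRank = 1 → BSDp W 2) ↔
      MinimalTwinBSDTwo ∧
        (∀ (W : WeierstrassCurve ℚ) [W.IsElliptic] [W.IsGloballyMinimal],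
          ¬ W.HasCM → W.analyticRank = 1 → (∀ P : W.toAffine.Point, 2 • P = 0 → P = 0) → Nat.card (W.selmerGroup 2) ≠ 2 → BSDp W 2) ∧
        (∀ (W : WeierstrassCurve ℚ) [W.IsElliptic] [W.IsGloballyMinimal],
          ¬ W.HasCM → W.analyticRank = 1 → (¬ ∀ P : W.toAffine.Point, 2 • P = 0 → P = 0) → BSDp W 2) := by
  constructor
  · intro h
    exact ⟨fun W _ _ hcm hr _ ↦ h W hcm hr, fun W _ _ hcm hr _ _ ↦ h W hcm hr, fun W _ _ hcm hr _ ↦ h W hcm hr⟩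
  · rintro ⟨hU, hS, hT⟩ W _ _ hcm hr
    by_cases htor : ∀ P : W.toAffine.Point, 2 • P = 0 → P = 0
    · exact rankOneNoTwoTorsion_of_minimalTwinBSDTwo_of_shaCell hU hS W hcm hr htor
    · exact hT W hcm hr htor

/-! ## §2 The Ш-cell in Ш-currency (modulo GZK) -/

/-- **The Ш-cell ⟺ «non-CM, `r_an = 1`, `W(ℚ)[2] = 0`, `Ш(W)[2] ≠ 0` ⟹ BSD₂»** modulo GZK: on a curve of analytic rank one without rational `2`-torsion,
`#Sel₂(W) ≠ 2 ⟺ #(Ш(W) ⊓ H¹(ℚ,W)[2]) ≠ 1` (p797081 `natCard_selmerGroup_two_ne_two_iff_of_analyticRank_one`).  So the cell that moves into the crux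
is the locus `Ш(W)[2] ≠ 0` (`#Sel₂(W) ≥ 8` at rank one), where the exact `2`-depth `M₀` of the Heegner point is `≥ 1` by KEX⁰.
[cite: SilvermanAEC2009, Thm X.4.2] -/
theorem shaCell_iff_shaCellSha (hGZK : rank_eq_analyticRank_of_analyticRank_le_one) :
    (∀ (W : WeierstrassCurve ℚ) [W.IsElliptic] [W.IsGloballyMinimal],
        ¬ W.HasCM → W.analyticRank = 1 → (∀ P : W.toAffine.Point, 2 • P = 0 → P = 0) → Nat.card (W.selmerGroup 2) ≠ 2 → BSDp W 2) ↔
      (∀ (W : WeierstrassCurve ℚ) [W.IsElliptic] [W.IsGloballyMinimal],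
        ¬ W.HasCM → W.analyticRank = 1 → (∀ P : W.toAffine.Point, 2 • P = 0 → P = 0) →
          Nat.card (W.sha ⊓ AddSubgroup.torsionBy W.galH1 2 : AddSubgroup W.galH1) ≠ 1 → BSDp W 2) := by
  constructor
  · intro h W _ _ hcm hr hT hSha
    exact h W hcm hr hT ((natCard_selmerGroup_two_ne_two_iff_of_analyticRank_one hGZK W hr).mpr (Or.inr hSha))
  · intro h W _ _ hcm hr hT hSel
    rcases (natCard_selmerGroup_two_ne_two_iff_of_analyticRank_one hGZK W hr).mp hSel with htor | hSha
    · exact absurd hT htor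
    · exact h W hcm hr hT hSha

/-! ## §3 The `closes`-shaped term with U₂ kept BY NAME: NonCMAtTwo ⟸ WALL(GK2)×4 + U₂ + Ш-cell + R″, and its lossless converse -/

/-- ★ **`closes`-shaped term for the re-cut WITH U₂ KEPT AS A NODE: the four GK2 WALL binders (BY NAME), U₂ `MinimalTwinBSDTwo` (BY NAME, 22985 — LINE 23's
conclusion), the Ш-cell and the torsion cell R″ give the leaf `NonCMAtTwo`.**  Seven binders, one cell each (rank `0` × four reduction types at `2`; rank `1`
× {`#Sel₂ = 2`, `W(ℚ)[2] = 0 ∧ #Sel₂ ≠ 2`, `W(ℚ)[2] ≠ 0`}), none idle.  = p798939's `nonCMAtTwo_of_wallGK2_of_rankOneNoTwoTorsion_of_torsionCell` ∘ §1.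
CONDITIONAL (all seven are hypotheses); proves nothing about BSD; closes nothing. [cite: Miller2011LMS, Def. 1.1] -/
theorem nonCMAtTwo_of_wallGK2_of_minimalTwinBSDTwo_of_shaCell_of_torsionCell (hOrd : WallGoodOrdinaryRankZeroAtTwo)
    (hMult : WallMultiplicativeRankZeroAtTwo) (hSS : WallSupersingularRankZeroAtTwo) (hAdd : WallAdditiveRankZeroAtTwo)
    (hTw : MinimalTwinBSDTwo)
    (hSha : ∀ (W : WeierstrassCurve ℚ) [W.IsElliptic] [W.IsGloballyMinimal],
      ¬ W.HasCM → W.analyticRank = 1 → (∀ P : W.toAffine.Point, 2 • P = 0 → P = 0) → Nat.card (W.selmerGroup 2) ≠ 2 → BSDp W 2)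
    (hT : ∀ (W : WeierstrassCurve ℚ) [W.IsElliptic] [W.IsGloballyMinimal],
      ¬ W.HasCM → W.analyticRank = 1 → (¬ ∀ P : W.toAffine.Point, 2 • P = 0 → P = 0) → BSDp W 2) :
    NonCMAtTwo :=
  nonCMAtTwo_of_wallGK2_of_rankOneNoTwoTorsion_of_torsionCell hOrd hMult hSS hAdd
    (rankOneNoTwoTorsion_of_minimalTwinBSDTwo_of_shaCell hTw hSha) hT

/-- ★ **NonCMAtTwo ⟺ WALL(GK2)×4 ∧ U₂ ∧ Ш-cell ∧ R″ — LOSSLESS, pure logic** (the leaf hands back every binder; no GZK needed in either direction).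
Census only; BSD is NOT proved. [cite: Miller2011LMS, Def. 1.1] -/
theorem nonCMAtTwo_iff_wallGK2_and_minimalTwinBSDTwo_and_shaCell_and_torsionCell :
    NonCMAtTwo ↔
      (WallGoodOrdinaryRankZeroAtTwo ∧ WallMultiplicativeRankZeroAtTwo ∧ WallSupersingularRankZeroAtTwo ∧ WallAdditiveRankZeroAtTwo) ∧
      MinimalTwinBSDTwo ∧
      (∀ (W : WeierstrassCurve ℚ) [W.IsElliptic] [W.IsGloballyMinimal],
        ¬ W.HasCM → W.analyticRank = 1 → (∀ P : W.toAffine.Point, 2 • P = 0 → P = 0) → Nat.card (W.selmerGroup 2) ≠ 2 → BSDp W 2) ∧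
      (∀ (W : WeierstrassCurve ℚ) [W.IsElliptic] [W.IsGloballyMinimal],
        ¬ W.HasCM → W.analyticRank = 1 → (¬ ∀ P : W.toAffine.Point, 2 • P = 0 → P = 0) → BSDp W 2) := by
  rw [nonCMAtTwo_iff_wallGK2_and_rankOneNoTwoTorsion_and_torsionCell]
  constructor
  · rintro ⟨hW, hU', hT⟩
    exact ⟨hW, fun W _ _ hcm hr _ ↦ by
        by_cases htor : ∀ P : W.toAffine.Point, 2 • P = 0 → P = 0
        · exact hU' W hcm hr htor
        · exact hT W hcm hr htor,
      shaCell_of_rankOneNoTwoTorsion hU', hT⟩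
  · rintro ⟨hW, hU, hS, hT⟩
    exact ⟨hW, rankOneNoTwoTorsion_of_minimalTwinBSDTwo_of_shaCell hU hS, hT⟩

/-! ## §4 The Ш-cell's road: WALL row 1 + Friedberg–Hoffstein + KEX⁰|Ш + PRINT (p796542's engine restricted to the cell), lossless -/

/-- ★ **THE Ш-CELL ⟸ WALL row 1 + Friedberg–Hoffstein + KEX⁰|Ш + PRINT.**  KEX⁰|Ш := KEX⁰ (p796542 §4's `hKEX0`: the `2`-primary Gross–Zagier index
relation `#Ш(W_K)[2^∞] · 4^{ord₂ c + ord₂ C(W)} = 4^{M₀}` at SOME exact `2`-depth `M₀` of `P(1)`, at every odd Heegner frame with `2` split and any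
globally minimal twin) RESTRICTED to the Ш-cell by the extra binder `#Sel₂(W) ≠ 2`; `hS1` = S1′ = BSD₂ for every non-CM globally minimal curve of
analytic rank `0` (the rank-zero consequence of the four WALL binders, p798939 `bsdp_rankZero_of_wallGK2`).  Proof = p796542
`bsdp_of_wall_of_friedbergHoffstein_of_kex0_of_facts` verbatim (that engine uses KEX⁰ only at the curve in hand).  CONDITIONAL on the displayed
hypotheses; proves nothing about BSD; closes nothing.  [cite: FriedbergHoffstein1995, main theorem] [cite: GrossZagier1986, V.§2 (2.2)]
[cite: SilvermanAEC2009, VIII.8 Cor. 8.3] [cite: BCDTJAMS2001, Thm. A] [cite: Milne1972ArithmeticAV, §1 Thm. 1] -/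
theorem shaCell_of_wall_of_friedbergHoffstein_of_kex0Sha_of_facts
    (hGZ : ∀ (N : ℕ) [NeZero N] (W : WeierstrassCurve ℚ) (K : Type) [Field K] [NumberField K], gross_zagier N W K)
    (hGZK : rank_eq_analyticRank_of_analyticRank_le_one) (hmod : hasEntireLFunction_rat)
    (hMilneC : Milne1972.bsdQuotient_baseChange_quadratic_anyModel) (hMP : nonempty_modularParametrizationData)
    (hFH : friedbergHoffstein_exists_heegnerField_split_twist_ne_zero)
    (hS1 : ∀ (W : WeierstrassCurve ℚ) [W.IsElliptic] [W.IsGloballyMinimal], ¬ W.HasCM → W.analyticRank = 0 → BSDp W 2)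
    (hKEX0Sha : ∀ (W : WeierstrassCurve ℚ) [W.IsElliptic] [W.IsGloballyMinimal] [NeZero (W.conductorNorm ℤ)],
      ¬ W.HasCM → W.analyticRank = 1 → (∀ P : W.toAffine.Point, 2 • P = 0 → P = 0) → Nat.card (W.selmerGroup 2) ≠ 2 →
      ∀ (K : Type) [Field K] [NumberField K], IsImaginaryQuadratic K →
        Odd (NumberField.discr K) → NumberField.discr K ≠ -3 → SatisfiesHeegnerHypothesis (W.conductorNorm ℤ) K →
        ((Ideal.span {(2 : ℤ)}).primesOver (𝓞 K)).ncard = 2 →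
        ∀ (Wd : WeierstrassCurve ℚ) [Wd.IsElliptic] [Wd.IsGloballyMinimal],
          (∃ C : VariableChange ℚ, C • W.quadraticTwist (NumberField.discr K : ℚ) = Wd) →
        (W.quadraticTwist (NumberField.discr K : ℚ)).entireLFunction 1 ≠ 0 →
        ∀ (Dt : ModularParametrizationData W (W.conductorNorm ℤ)) (β : ℤ) (ι : K →+* ℂ) (d₁ : KolyvaginHeegnerData Dt β ι 1),
          ∃ M₀ : ℕ,
            (∃ Q : (W.baseChange (ringClassField K ι 1)).toAffine.Point, ((2 ^ M₀ : ℕ) : ℤ) • Q = d₁.derivedPoint) ∧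
            (¬ ∃ Q : (W.baseChange (ringClassField K ι 1)).toAffine.Point, ((2 ^ (M₀ + 1) : ℕ) : ℤ) • Q = d₁.derivedPoint) ∧
            Nat.card (AddCommGroup.primaryComponent (W.baseChange K).sha 2) *
                2 ^ (2 * (padicValInt 2 Dt.c + padicValNat 2 W.tamagawaProduct)) = 2 ^ (2 * M₀)) :
    ∀ (W : WeierstrassCurve ℚ) [W.IsElliptic] [W.IsGloballyMinimal], ¬ W.HasCM → W.analyticRank = 1 →
      (∀ P : W.toAffine.Point, 2 • P = 0 → P = 0) → Nat.card (W.selmerGroup 2) ≠ 2 → BSDp W 2 := by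
  intro W _ _ hcm hr hT2 hSel
  haveI : NeZero (W.conductorNorm ℤ) := ⟨(W.conductorNorm_pos_holds).ne'⟩
  -- the sign of the functional equation: `w(W) = −1` from `r_an(W) = 1`
  obtain ⟨Dt₀⟩ := hMP W
  have hw : W.rootNumber = -1 := by
    rcases Literature.NumberTheory.EllipticCurves.rootNumber_eq_one_or_eq_neg_one W with h1 | h1
    · exfalso
      have hev : Even W.analyticRank :=
        (Literature.Barriers.BirchSwinnertonDyer.even_analyticRank_iff_of_isNewformOf_conductorLevel Dt₀.isNewformOf).mpr h1
      rw [hr] at hev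
      exact Nat.not_even_one hev
    · exact h1
  -- Friedberg–Hoffstein: an imaginary quadratic Heegner field with `2` split, `|d_K| > 4` and `L(W^{(d_K)},1) ≠ 0`
  obtain ⟨K, _, _, hK, hB, hH, h2H, hL⟩ := hFH W hw 2 Nat.prime_two 4
  have h2 : Module.finrank ℚ K = 2 := hK.1
  have h2K : ((Ideal.span {(2 : ℤ)}).primesOver (𝓞 K)).ncard = 2 := by
    simpa using h2H 2 Nat.prime_two (dvd_refl 2)
  have hodd : Odd (NumberField.discr K) := by
    have h8 := (ncard_primesOver_two_eq_two_iff (K := K) h2).mp h2K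
    rw [Int.odd_iff]; omega
  have h3 : NumberField.discr K ≠ -3 := by
    intro h; rw [h] at hB; simp at hB
  -- a globally minimal model of the twist
  have hD0 : (NumberField.discr K : ℚ) ≠ 0 := by exact_mod_cast NumberField.discr_ne_zero K
  haveI := W.isElliptic_quadraticTwist hD0
  obtain ⟨Cd, hmin⟩ := hasGlobalMinimalModel_rat_holds (W.quadraticTwist (NumberField.discr K : ℚ))
  haveI := hmin
  -- a conductor-1 datum and its Heegner point of infinite order
  obtain ⟨Dt, β, ι, d₁, hc0⟩ := exists_kolyvaginHeegnerData_one_of_nonempty_modularParametrizationData hMP W K hK hH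
  have hy : ¬ IsOfFinAddOrder d₁.derivedPoint :=
    not_isOfFinAddOrder_derivedPoint_one_of_rankOne_of_lValue_ne_zero hmod W K (hGZ _ W K) hK hH hr hL d₁
  -- KEX⁰|Ш at this curve: the exact depth and the index relation
  obtain ⟨M₀, hdiv, hndiv, hsha⟩ :=
    hKEX0Sha W hcm hr hT2 hSel K hK hodd h3 hH h2K (Cd • W.quadraticTwist (NumberField.discr K : ℚ)) ⟨Cd, rfl⟩ hL Dt β ι d₁
  -- the twin is non-CM of analytic rank 0: `BSD₂(Wd)` from the wall
  have hcmd : ¬ (Cd • W.quadraticTwist (NumberField.discr K : ℚ)).HasCM := by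
    rw [hasCM_iff_of_j_eq (((W.quadraticTwist (NumberField.discr K : ℚ)).variableChange_j Cd).trans (W.j_quadraticTwist hD0))]
    exact hcm
  have hrd : (Cd • W.quadraticTwist (NumberField.discr K : ℚ)).analyticRank = 0 := by
    rw [analyticRank_smul]
    exact ((W.quadraticTwist (NumberField.discr K : ℚ)).analyticRank_eq_zero_iff_holds (hmod _)).mpr hL
  have hBd : BSDp (Cd • W.quadraticTwist (NumberField.discr K : ℚ)) 2 := hS1 _ hcmd hrd
  exact swappedPairDescentAtTwo_shaDepth_noTwoTorsion_of_facts hGZ hGZK hmod hMilneC W hr hT2 K hK hodd h3 hH Dt hc0 β ι d₁ hy M₀ hdiv hndiv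
    hsha (Cd • W.quadraticTwist (NumberField.discr K : ℚ)) ⟨Cd, rfl⟩ hBd

/-- ★ **KEX⁰|Ш IS LOSSLESS**: the Ш-cell (the CONCLUSION of the previous theorem) + S1′ + PRINT ⟹ KEX⁰|Ш (its research hypothesis, text VERBATIM;
Friedberg–Hoffstein is not needed in this direction).  Proof = p796542 `kex0_of_rankOneNoTwoTorsionBSDTwo_of_wall_of_facts` verbatim with the extra
binder.  So modulo WALL row 1 + PRINT, KEX⁰|Ш ⟺ the Ш-cell: the ONE new statement of the re-cut is in U₂'s Kolyvagin currency.  CONDITIONAL; proves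
nothing about BSD; closes nothing.  [cite: GrossZagier1986, V.§2 (2.2)] [cite: Milne1972ArithmeticAV, §1 Thm. 1] [cite: SilvermanAEC2009, Thm. VIII.6.7] -/
theorem kex0Sha_of_shaCell_of_wall_of_facts
    (hGZ : ∀ (N : ℕ) [NeZero N] (W : WeierstrassCurve ℚ) (K : Type) [Field K] [NumberField K], gross_zagier N W K)
    (hGZK : rank_eq_analyticRank_of_analyticRank_le_one) (hmod : hasEntireLFunction_rat)
    (hMilneC : Milne1972.bsdQuotient_baseChange_quadratic_anyModel)
    (hS1 : ∀ (W : WeierstrassCurve ℚ) [W.IsElliptic] [W.IsGloballyMinimal], ¬ W.HasCM → W.analyticRank = 0 → BSDp W 2)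
    (hSha : ∀ (W : WeierstrassCurve ℚ) [W.IsElliptic] [W.IsGloballyMinimal],
      ¬ W.HasCM → W.analyticRank = 1 → (∀ P : W.toAffine.Point, 2 • P = 0 → P = 0) → Nat.card (W.selmerGroup 2) ≠ 2 → BSDp W 2) :
    ∀ (W : WeierstrassCurve ℚ) [W.IsElliptic] [W.IsGloballyMinimal] [NeZero (W.conductorNorm ℤ)],
      ¬ W.HasCM → W.analyticRank = 1 → (∀ P : W.toAffine.Point, 2 • P = 0 → P = 0) → Nat.card (W.selmerGroup 2) ≠ 2 →
      ∀ (K : Type) [Field K] [NumberField K], IsImaginaryQuadratic K →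
        Odd (NumberField.discr K) → NumberField.discr K ≠ -3 → SatisfiesHeegnerHypothesis (W.conductorNorm ℤ) K →
        ((Ideal.span {(2 : ℤ)}).primesOver (𝓞 K)).ncard = 2 →
        ∀ (Wd : WeierstrassCurve ℚ) [Wd.IsElliptic] [Wd.IsGloballyMinimal],
          (∃ C : VariableChange ℚ, C • W.quadraticTwist (NumberField.discr K : ℚ) = Wd) →
        (W.quadraticTwist (NumberField.discr K : ℚ)).entireLFunction 1 ≠ 0 →
        ∀ (Dt : ModularParametrizationData W (W.conductorNorm ℤ)) (β : ℤ) (ι : K →+* ℂ) (d₁ : KolyvaginHeegnerData Dt β ι 1),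
          ∃ M₀ : ℕ,
            (∃ Q : (W.baseChange (ringClassField K ι 1)).toAffine.Point, ((2 ^ M₀ : ℕ) : ℤ) • Q = d₁.derivedPoint) ∧
            (¬ ∃ Q : (W.baseChange (ringClassField K ι 1)).toAffine.Point, ((2 ^ (M₀ + 1) : ℕ) : ℤ) • Q = d₁.derivedPoint) ∧
            Nat.card (AddCommGroup.primaryComponent (W.baseChange K).sha 2) *
                2 ^ (2 * (padicValInt 2 Dt.c + padicValNat 2 W.tamagawaProduct)) = 2 ^ (2 * M₀) := by
  intro W _ _ _ hcm hr hT2 hSel K _ _ hK hodd h3 hH _h2K Wd _ _ hWd hL Dt β ι d₁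
  obtain ⟨Cd, hCd⟩ := hWd
  have hD0 : (NumberField.discr K : ℚ) ≠ 0 := by exact_mod_cast NumberField.discr_ne_zero K
  haveI := W.isElliptic_quadraticTwist hD0
  have hcmd : ¬ Wd.HasCM := by
    rw [← hCd, hasCM_iff_of_j_eq (((W.quadraticTwist (NumberField.discr K : ℚ)).variableChange_j Cd).trans (W.j_quadraticTwist hD0))]
    exact hcm
  have hrd : Wd.analyticRank = 0 := by
    rw [← hCd, analyticRank_smul]
    exact ((W.quadraticTwist (NumberField.discr K : ℚ)).analyticRank_eq_zero_iff_holds (hmod _)).mpr hL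
  have hy : ¬ IsOfFinAddOrder d₁.derivedPoint :=
    not_isOfFinAddOrder_derivedPoint_one_of_rankOne_of_lValue_ne_zero hmod W K (hGZ _ W K) hK hH hr hL d₁
  haveI := (finiteDimensional_and_isGalois_ringClassField hK ι one_ne_zero).1
  haveI : NumberField (ringClassField K ι 1) := NumberField.of_module_finite K _
  haveI : (W.baseChange (ringClassField K ι 1)).IsElliptic := by rw [baseChange]; infer_instance
  haveI : Module.Finite ℤ (W.baseChange (ringClassField K ι 1)).toAffine.Point := by
    convert (W.baseChange (ringClassField K ι 1)).module_finite_point_holds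
  obtain ⟨M₀, hdiv, hndiv⟩ := exists_exactTwoDepth
    (A := (W.baseChange (ringClassField K ι 1)).toAffine.Point) (y := d₁.derivedPoint) (by convert hy)
  have hc0 : Dt.c ≠ 0 := fun h ↦ Dt.cast_c_ne_zero (by rw [h, Int.cast_zero])
  exact ⟨M₀, hdiv, hndiv, natCard_sha_mul_eq_of_bsdp_noTwoTorsion W K (hGZ _ W K) hGZK hmod hMilneC hr hT2 hK hodd h3 hH Dt hc0 β ι d₁ hy hdiv
    hndiv Wd ⟨Cd, hCd⟩ (hSha W hcm hr hT2 hSel) (hS1 Wd hcmd hrd)⟩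

end Summit.BirchSwinnertonDyer.BirchSwinnertonDyer.Theorems.GenusExact.Census.ShaCell

end
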